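import Mathlib
import Summits.ValiantsHypothesis.ValiantsHypothesis.Theses.NewtonUnitEquations
import Summits.ValiantsHypothesis.ValiantsHypothesis.Theorems.DissociatedFixedK.Negative.CubeLemma
import Summits.ValiantsHypothesis.ValiantsHypothesis.Theorems.DissociatedFixedK.Negative.LoadBearing

/-!
# Line `annihilator-product-functional` — checked skeleton (v3) for crux `DissociatedFixedK`
(stmt-ValiantsHypothesis-5907, route NewtonUnitEquations, rank 4; crux-plan gen 2.  v3 MIRRORS THE LEAD'S CUT:
the lead prover `line-stmt-ValiantsHypothesis-5907` picked this line at 02:28Z and registered THREE stubs at 02:29Z —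
`stub_thicknessFit`, `stub_exposedWord`, `stub_topTupleCount` — i.e. the gen-1 skeleton with the lever's fit made a
registered stub so that it can LAND as its own ≤ 400-line Theorems file via `propose --supports` (only registered-stub
matches are creditable).  This file adopts exactly that cut, with the lead's stub names and signature texts verbatim,
and supplies the protocol shape around it.)

Crux (FIXED, never restated):
`Summit.ValiantsHypothesis.ValiantsHypothesis.Theses.NewtonUnitEquations.DissociatedFixedK` =
`∀ k, ∃ C, ∀ m t (A : Fin m → Finset (Fin 2 →₀ ℕ)) (f : Fin k → Fin m → MvPolynomial (Fin 2) ℂ),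
(∀ j, #A j ≤ t) → (∀ i j, supp f i j ⊆ A j) → (sum map injective on Π_j A j) →
#extremePoints (conv (emb '' supp (Σ_i Π_j f i j))) ≤ (m t + 2) ^ C`.

## Shape of this file (protocol: 2–7 registered `stub_*` + `<Crux>_of`, audited by name)
* §0  the LEVER, PROVED (no sorry): `productFunctional_rankOne`, `exists_annihilator`, `thickness_of_annihilator`
  (the annihilating product functional: thickness `≤ k-1` with dead letters, induction- and division-free).
* §1  the three stub STATEMENTS as named propositions `Stmt.stub_thicknessFit`, `Stmt.stub_exposedWord`,
  `Stmt.stub_topTupleCount` (textually the registered signatures), and `thickness_fit_proof : Stmt.stub_thicknessFit`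
  — the lever's fit to a vertex PROVED from §0 (no sorry): the kernel-closed witness that the first stub is true.
* §2  the three REGISTERED STUBS (`sorry` lives ONLY here): `stub_thicknessFit` (proof = §1, to be landed as a
  `--supports` helper file), `stub_exposedWord`, `stub_topTupleCount` (proofs = Disproof kit §E / FullProof, to be ported).
* §3  encoding helpers (PROVED).
* §4  the COMPOSITION `DissociatedFixedK_of : Stmt.stub_thicknessFit → Stmt.stub_exposedWord → Stmt.stub_topTupleCount →
  DissociatedFixedK` — a real proof, axioms {propext, Classical.choice, Quot.sound} — and the by-name skeleton theorem
  `DissociatedFixedK_proof : DissociatedFixedK := DissociatedFixedK_of @stub_thicknessFit @stub_exposedWord stub_topTupleCount`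
  (closure = the three stubs' sorries, nothing else; its elaboration is the kernel's check that each `Stmt.stub_X` and the
  registered signature of `stub_X` are the same proposition).  Both conclude the route decl BY NAME.

## The line (idea card `Ideas/annihilator-product-functional.md`, triage r1: pass ×3 (+ gen-2 r1-2: pass))

Write `c i j e = coeff e (f i j)` and `T(a) = Σ_i Π_j c i j (a j)` for a grid word `a ∈ Π_j A j`.

* `stub_exposedWord`  (blueprint steps 1–2: dictionary + strict exposure).  Every vertex `p` of the
  Newton polygon is `emb (Σ_j a_j)` for a grid word `a` with `T(a) ≠ 0`, and some continuous linear
  functional `l` on `ℝ²` makes `a` the STRICT `l`-top among all surviving words (`T ≠ 0`).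
  [dissociation and `supp ⊆ A` are used exactly here; no genericity of `l` is required anywhere]
* `stub_thicknessFit`  (blueprint step 3, THIS LINE'S LEVER fitted to a vertex; PROVED in §1 as
  `thickness_fit_proof`).  If `a` is the strict `l`-top survivor and `b` is any word that is letterwise
  `l`-above `a` and alive in every product alive at `a`, then `b` and `a` differ in `< k` coordinates.
  Proof: restrict `T` to the sub-cube `Π_{j : b j ≠ a j} {a j, b j}` (all other cube words are `l`-≥ `a`,
  `≠ a`, hence cancelled) and apply `thickness_of_annihilator`: one product functional `Λ_λ` with
  `λ_j = (0,1)` on a dead coordinate per dead product and `λ_{ι i} = (φ_i(1), -φ_i(0))` along an injection of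
  the alive products kills every rank-one term but not `T|_cube = T(a)·δ_a`.  Same statement shape as the
  LANDED `Theorems/DissociatedFixedK/Negative/CubeLemma.lean` `mixed_cube_lemma` (p73482).
* `stub_topTupleCount`  (blueprint step 4: counting).  For letter sets `S j ⊆ ℕ²` with `#S j ≤ t`, the
  tuples `b ∈ Π_j S j` that are, for SOME functional `l`, coordinatewise maximal for the lexicographic
  key `(l (emb e), e 0, e 1)` number `≤ 4 (m t)² + 7` (comparison patterns of `l` on the `≤ m t`
  letters; = Disproof.lean v4 §E3/§E4 `ncard_range_topTuple_le`, or the keyed sweep of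
  `SketchIdeator2.sweep_boxTop_ncard_le`).
* `DissociatedFixedK_of` (the composition): for a vertex `p` take `(a, l)` from the exposure hypothesis,
  the alive pattern `I = {i : ∀ j, c i j (a j) ≠ 0}`, the alive box `C I j = {e ∈ A j : ∀ i ∈ I, c i j e ≠ 0} ∋ a j`,
  and `b j` a lex-key-maximal letter of `C I j`; the thickness hypothesis gives `#{j : b j ≠ a j} < k`, so `a`
  is `b` overwritten by `< k` (coordinate, letter) pairs.  Encoding `p ↦ (I, slot list of the overwritten
  pairs, b)` covers the vertex set by a finset of size `≤ 2^k · (m t + 1)^k · (4 (m t)² + 7) ≤ (m t + 2)^(2k+3)`,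
  i.e. `C = 2 k + 3`.

## Disproof.lean (v4, 02:07Z, read in full) obligations honoured
`dissociatedFixedK_false_without_card` (landed, `Negative/LoadBearing.lean` p74111): `#A j ≤ t` enters
`stub_topTupleCount` (`#S j ≤ t`) and the slot count `(1 + Σ_j #A j)^k ≤ (m t + 1)^k`.
`…_false_without_supp` (landed, ibid.): `supp f i j ⊆ A j` enters `stub_exposedWord` (dictionary).
Dissociation: only in `stub_exposedWord` (as Disproof §B predicts).  §A' sharpness (landed `Negative/CubeLemma.lean`:
`cube_lemma_sharp_one/_two`): `stub_thicknessFit` states exactly `< k` (attained), never `< k - 1`.  §C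
(`¬ UniformC`): `C = 2k + 3` grows with `k`.  §F (the disprover's own sorry-free proof, `dissociatedFixedK_holds`,
thickness via `mixed_cube_lemma`, Hamming-ball count): independent of and consistent with this line.  `-- Targets`:
none; `-- NEAR-MISSES`: none.  No stub is an instance of a landed Negative lemma's negation (`¬Without{Card,Supp}`
concern DELETED hypotheses; every stub keeps the hypotheses it uses) — see `scratch-negative.lean` (evidence), which
puts the landed `Negative/*` modules next to these declarations and derives the lever's statement from
`mixed_cube_lemma` and back.

## Versions of this file
gen 1 (02:11Z, commit 96c51e19e518): 2 stubs, `thickness_fit` proved inline, `DissociatedFixedK_of : DissociatedFixedK`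
by name.  v2 (gen 2, 02:33Z, b8518e50b00c): protocol shape `_of : Stmt… → crux` + `_proof`, 2 stubs with explicit
binders — SUPERSEDED 20 minutes later by this v3 because the lead had meanwhile registered the 3-stub cut with gen-1's
binder texts; v3 = that cut verbatim (so `--supports` proofs of the lead's workers match the registry whichever of
the two seats ran `skeleton check` last) + the protocol shape + the in-file proof of the first stub.  Mathematics,
constants and proofs are unchanged throughout.

Namespace private to this line.  `sorry` occurs ONLY in the three `stub_*` theorems.  Ready proofs: `stub_thicknessFit`
= §1 `thickness_fit_proof` (this file); `stub_exposedWord` = Disproof.lean v4 §E0–§E1 / `FullProof-….lean` `exposedWord`;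
`stub_topTupleCount` = Disproof.lean v4 §E2–§E4 / `FullProof-….lean` `topTupleCount` (Cruxes workfiles — to be ported into
`Theorems/` by provers with `propose --supports stmt-ValiantsHypothesis-5907`, not importable from there).
-/

set_option linter.unusedVariables false
set_option linter.dupNamespace false

namespace Summit.ValiantsHypothesis.ValiantsHypothesis.Cruxes.DissociatedFixedK.AnnihilatorProductFunctional

open scoped BigOperators Classical

noncomputable section

/-! ## §0  The lever, PROVED (ideator 3, `SketchIdeator3.lean`; re-checked here) -/

/-- The product functional `Λ_λ(h) = Σ_y (Π_j λ_j(y_j)) h(y)` on functions of the Boolean cube factors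
on a rank-one function: `Λ_λ(⊗ ψ_j) = Π_j (λ_j(0)ψ_j(0) + λ_j(1)ψ_j(1))`. -/
theorem productFunctional_rankOne {J : Type*} [Fintype J] [DecidableEq J]
    (lam ψ : J → Bool → ℂ) :
    ∑ y : J → Bool, (∏ j, lam j (y j)) * ∏ j, ψ j (y j)
      = ∏ j, (lam j false * ψ j false + lam j true * ψ j true) := by
  have h := Finset.prod_univ_sum (fun _ : J => (Finset.univ : Finset Bool))
    (fun j b => lam j b * ψ j b)
  simp only [Fintype.piFinset_univ] at h
  have h' : ∀ j : J, (∑ b : Bool, lam j b * ψ j b)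
      = lam j false * ψ j false + lam j true * ψ j true := by
    intro j
    rw [Fintype.sum_bool]
    ring
  simp only [h'] at h
  rw [h]
  refine Finset.sum_congr rfl fun y _ => ?_
  rw [← Finset.prod_mul_distrib]

/-- Existence of the annihilating product functional: `λ_j = (0,1)` on one dead coordinate per dead
live term, `λ_{ι i} = (φ_i(1), -φ_i(0))` along an injection `ι` of the alive terms into the other
coordinates (it exists because `k ≤ |J|`). -/
theorem exists_annihilator {k : ℕ} {J : Type*} [Fintype J] [DecidableEq J]
    (x : Fin k → ℂ) (φ : Fin k → J → Bool → ℂ)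
    (hstruct : ∀ i, x i = 0 ∨ (∀ j, φ i j false ≠ 0) ∨ (∃ j, φ i j true = 0))
    (hk : k ≤ Fintype.card J) :
    ∃ lam : J → Bool → ℂ, (∀ j, lam j true ≠ 0) ∧
      ∀ i, x i = 0 ∨ ∃ j, lam j false * φ i j false + lam j true * φ i j true = 0 := by
  classical
  rcases isEmpty_or_nonempty J with hJ | hJ
  · refine ⟨fun _ _ => 1, fun j => one_ne_zero, fun i => ?_⟩
    have : Fintype.card J = 0 := Fintype.card_eq_zero
    exact absurd i.2 (by omega)
  -- dead terms and a dead coordinate for each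
  let dead : Finset (Fin k) := Finset.univ.filter fun i => x i ≠ 0 ∧ ∃ j, φ i j true = 0
  have hdead : ∀ i ∈ dead, ∃ j, φ i j true = 0 := fun i hi => (Finset.mem_filter.1 hi).2.2
  choose! jd hjd using hdead
  let D : Finset J := dead.image jd
  let alive : Finset (Fin k) := Finset.univ.filter fun i => x i ≠ 0 ∧ ∀ j, φ i j true ≠ 0
  have halive_false : ∀ i ∈ alive, ∀ j, φ i j false ≠ 0 := by
    intro i hi j
    have hi' := (Finset.mem_filter.1 hi).2
    rcases hstruct i with h0 | hf | ⟨j', hj'⟩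
    · exact absurd h0 hi'.1
    · exact hf j
    · exact absurd hj' (hi'.2 j')
  have hdisj : Disjoint alive dead := by
    rw [Finset.disjoint_left]
    intro i h1 h2
    obtain ⟨j, hj⟩ := (Finset.mem_filter.1 h2).2.2
    exact (Finset.mem_filter.1 h1).2.2 j hj
  have hcard1 : alive.card + dead.card ≤ k := by
    rw [← Finset.card_union_of_disjoint hdisj]
    exact (Finset.card_le_univ _).trans (by simp)
  have hD : D.card ≤ dead.card := Finset.card_image_le
  have hDJ : D.card ≤ Fintype.card J := (Finset.card_le_univ D)
  have hcard2 : alive.card ≤ Fintype.card J - D.card := by omega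
  -- an embedding of the alive terms into the non-dead coordinates
  have hemb : Nonempty (alive ↪ (Finset.univ \ D : Finset J)) := by
    apply Function.Embedding.nonempty_of_card_le
    rw [Fintype.card_coe, Fintype.card_coe, Finset.card_sdiff_of_subset (Finset.subset_univ D),
      Finset.card_univ]
    exact hcard2
  obtain ⟨e⟩ := hemb
  have key : ∀ (a : alive)
      (h : ∃ a' : alive, ((e a' : (Finset.univ \ D : Finset J)) : J)
        = ((e a : (Finset.univ \ D : Finset J)) : J)),
      h.choose = a := by
    intro a h
    exact e.injective (Subtype.ext h.choose_spec)
  have heD : ∀ a : alive, ((e a : (Finset.univ \ D : Finset J)) : J) ∉ D :=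
    fun a => (Finset.mem_sdiff.1 (e a).2).2
  -- the functional's factors, with their three evaluation rules
  obtain ⟨lam, hlamD, hlamA, hlamO⟩ : ∃ lam : J → Bool → ℂ,
      (∀ j ∈ D, lam j = fun b => cond b 1 0) ∧
      (∀ a : alive, lam ((e a : (Finset.univ \ D : Finset J)) : J)
        = fun b => cond b (-(φ (a : Fin k) ((e a : (Finset.univ \ D : Finset J)) : J) false))
            (φ (a : Fin k) ((e a : (Finset.univ \ D : Finset J)) : J) true)) ∧
      (∀ j ∉ D, (¬ ∃ a : alive, ((e a : (Finset.univ \ D : Finset J)) : J) = j) →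
        lam j = fun b => cond b 1 0) := by
    refine ⟨fun j => if hj : j ∈ D then (fun b => cond b 1 0)
      else if h : ∃ a : alive, ((e a : (Finset.univ \ D : Finset J)) : J) = j then
        (fun b => cond b (-(φ (h.choose : Fin k) j false)) (φ (h.choose : Fin k) j true))
      else (fun b => cond b 1 0), ?_, ?_, ?_⟩
    · intro j hj
      simp only [dif_pos hj]
    · intro a
      have h : ∃ a' : alive, ((e a' : (Finset.univ \ D : Finset J)) : J)
          = ((e a : (Finset.univ \ D : Finset J)) : J) := ⟨a, rfl⟩
      simp only [dif_neg (heD a), dif_pos h]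
      rw [key a h]
    · intro j hj hne
      simp only [dif_neg hj, dif_neg hne]
  refine ⟨lam, ?_, ?_⟩
  · intro j
    by_cases hjD : j ∈ D
    · rw [hlamD j hjD]; exact one_ne_zero
    · by_cases h : ∃ a : alive, ((e a : (Finset.univ \ D : Finset J)) : J) = j
      · obtain ⟨a, rfl⟩ := h
        rw [hlamA a]
        exact neg_ne_zero.2 (halive_false _ a.2 _)
      · rw [hlamO j hjD h]; exact one_ne_zero
  · intro i
    by_cases hx : x i = 0
    · exact Or.inl hx
    right
    by_cases hdi : ∃ j, φ i j true = 0
    · -- dead term: its chosen coordinate lies in D and λ = (0,1) there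
      have hi : i ∈ dead := Finset.mem_filter.2 ⟨Finset.mem_univ _, hx, hdi⟩
      refine ⟨jd i, ?_⟩
      have hjD : jd i ∈ D := Finset.mem_image_of_mem jd hi
      rw [hlamD _ hjD, hjd i hi]
      simp
    · -- alive term: use the coordinate e ⟨i, _⟩
      push Not at hdi
      have hi : i ∈ alive := Finset.mem_filter.2 ⟨Finset.mem_univ _, hx, hdi⟩
      refine ⟨((e ⟨i, hi⟩ : (Finset.univ \ D : Finset J)) : J), ?_⟩
      rw [hlamA ⟨i, hi⟩]
      simp only [cond_true, cond_false]
      ring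

/-- **Dual-witness thickness on the two-letter sub-cube** (the lever; PROVED).  `x i` = value of term
`i` outside the deviation coordinates `J`; `φ i j true` = coefficient at the survivor's letter `a j`,
`φ i j false` = coefficient at the box letter `b j`.  Structure hypothesis: every term is negligible
(`x i = 0`), alive at the `false` corner, or dead at the `true` corner in some coordinate.  All cube
points other than the all-`true` corner are cancelled, the corner itself survives ⇒ `|J| < k`. -/
theorem thickness_of_annihilator {k : ℕ} {J : Type*} [Fintype J] [DecidableEq J]
    (x : Fin k → ℂ) (φ : Fin k → J → Bool → ℂ)
    (hstruct : ∀ i, x i = 0 ∨ (∀ j, φ i j false ≠ 0) ∨ (∃ j, φ i j true = 0))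
    (hzero : ∀ y : J → Bool, y ≠ (fun _ => true) → ∑ i, x i * ∏ j, φ i j (y j) = 0)
    (htop : ∑ i, x i * ∏ j, φ i j true ≠ 0) :
    Fintype.card J < k := by
  classical
  by_contra hk
  push Not at hk
  obtain ⟨lam, hlam1, hlam2⟩ := exists_annihilator x φ hstruct hk
  -- the functional applied to g, computed two ways
  let g : (J → Bool) → ℂ := fun y => ∑ i, x i * ∏ j, φ i j (y j)
  have way1 : ∑ y : J → Bool, (∏ j, lam j (y j)) * g y = (∏ j, lam j true) * g (fun _ => true) := by
    rw [Finset.sum_eq_single (fun _ => true)]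
    · intro y _ hy
      rw [show g y = 0 from hzero y hy, mul_zero]
    · intro h; exact absurd (Finset.mem_univ _) h
  have way2 : ∑ y : J → Bool, (∏ j, lam j (y j)) * g y
      = ∑ i, x i * ∏ j, (lam j false * φ i j false + lam j true * φ i j true) := by
    have : ∀ y : J → Bool, (∏ j, lam j (y j)) * g y
        = ∑ i, x i * ((∏ j, lam j (y j)) * ∏ j, φ i j (y j)) := by
      intro y
      simp only [g, Finset.mul_sum]
      refine Finset.sum_congr rfl fun i _ => ?_
      ring
    simp only [this]
    rw [Finset.sum_comm]
    refine Finset.sum_congr rfl fun i _ => ?_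
    rw [← Finset.mul_sum, productFunctional_rankOne]
  have hvan : ∑ i, x i * ∏ j, (lam j false * φ i j false + lam j true * φ i j true) = 0 := by
    refine Finset.sum_eq_zero fun i _ => ?_
    rcases hlam2 i with h0 | ⟨j, hj⟩
    · rw [h0, zero_mul]
    · rw [Finset.prod_eq_zero (Finset.mem_univ j) hj, mul_zero]
  have hprod : (∏ j, lam j true) ≠ 0 := Finset.prod_ne_zero_iff.2 fun j _ => hlam1 j
  have : (∏ j, lam j true) * g (fun _ => true) = 0 := by rw [← way1, way2, hvan]
  rcases mul_eq_zero.1 this with h | h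
  · exact hprod h
  · exact htop h


/-! ## §1  The stub STATEMENTS as named propositions, and the PROOF of the first one -/

/-! Each `Stmt.stub_X` is, textually, the registered signature of the stub `stub_X` of §2 with its binder list
turned into `∀` (binder kinds included); `DissociatedFixedK_proof` (§4) type-checks
`DissociatedFixedK_of @stub_thicknessFit @stub_exposedWord stub_topTupleCount`, the kernel's confirmation that the
copies agree. -/
namespace Stmt

/-- Statement of `stub_thicknessFit` (blueprint step 3: the lever's fit to a vertex). -/
def stub_thicknessFit : Prop :=
  ∀ {k m : ℕ} (A : Fin m → Finset (Fin 2 →₀ ℕ))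
    (c : Fin k → Fin m → (Fin 2 →₀ ℕ) → ℂ) (l : (Fin 2 → ℝ) →L[ℝ] ℝ)
    (a b : Fin m → (Fin 2 →₀ ℕ)) (ha : ∀ j, a j ∈ A j) (hb : ∀ j, b j ∈ A j)
    (hTa : (∑ i, ∏ j, c i j (a j)) ≠ 0)
    (htop : ∀ a' : Fin m → (Fin 2 →₀ ℕ), (∀ j, a' j ∈ A j) → a' ≠ a →
      (∑ i, ∏ j, c i j (a' j)) ≠ 0 →
      l (fun i : Fin 2 => (((∑ j, a' j) i : ℕ) : ℝ)) < l (fun i : Fin 2 => (((∑ j, a j) i : ℕ) : ℝ)))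
    (hbI : ∀ i, (∀ j, c i j (a j) ≠ 0) → ∀ j, c i j (b j) ≠ 0)
    (hba : ∀ j, l (fun i : Fin 2 => (((a j) i : ℕ) : ℝ)) ≤ l (fun i : Fin 2 => (((b j) i : ℕ) : ℝ))),
    (Finset.univ.filter fun j => b j ≠ a j).card < k

/-- Statement of `stub_exposedWord` (blueprint steps 1–2: dictionary + strict exposure). -/
def stub_exposedWord : Prop :=
  ∀ {k m : ℕ} (A : Fin m → Finset (Fin 2 →₀ ℕ))
    (f : Fin k → Fin m → MvPolynomial (Fin 2) ℂ)
    (hf : ∀ i j, (f i j).support ⊆ A j)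
    (hinj : ∀ a b : Fin m → (Fin 2 →₀ ℕ), (∀ j, a j ∈ A j) → (∀ j, b j ∈ A j) →
      ∑ j, a j = ∑ j, b j → a = b)
    (p : Fin 2 → ℝ)
    (hp : p ∈ Set.extremePoints ℝ (convexHull ℝ
      ((fun e : Fin 2 →₀ ℕ => fun i : Fin 2 => ((e i : ℕ) : ℝ)) ''
        ((∑ i, ∏ j, f i j).support : Set (Fin 2 →₀ ℕ))))),
    ∃ (a : Fin m → (Fin 2 →₀ ℕ)) (l : (Fin 2 → ℝ) →L[ℝ] ℝ),
      (∀ j, a j ∈ A j) ∧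
      p = (fun i : Fin 2 => (((∑ j, a j) i : ℕ) : ℝ)) ∧
      (∑ i, ∏ j, (f i j).coeff (a j)) ≠ 0 ∧
      ∀ a' : Fin m → (Fin 2 →₀ ℕ), (∀ j, a' j ∈ A j) → a' ≠ a →
        (∑ i, ∏ j, (f i j).coeff (a' j)) ≠ 0 →
        l (fun i : Fin 2 => (((∑ j, a' j) i : ℕ) : ℝ)) < l (fun i : Fin 2 => (((∑ j, a j) i : ℕ) : ℝ))

/-- Statement of `stub_topTupleCount` (blueprint step 4: the box tops over all functionals are few). -/
def stub_topTupleCount : Prop :=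
  ∀ (m t : ℕ) (S : Fin m → Finset (Fin 2 →₀ ℕ)) (hS : ∀ j, (S j).card ≤ t),
    ((Fintype.piFinset S).filter fun b : Fin m → (Fin 2 →₀ ℕ) =>
        ∃ l : (Fin 2 → ℝ) →L[ℝ] ℝ, ∀ j, ∀ e ∈ S j,
          (toLex (l (fun i : Fin 2 => ((e i : ℕ) : ℝ)), toLex (e 0, e 1)) : Lex (ℝ × Lex (ℕ × ℕ)))
            ≤ toLex (l (fun i : Fin 2 => (((b j) i : ℕ) : ℝ)), toLex ((b j) 0, (b j) 1))).card
      ≤ 4 * (m * t) ^ 2 + 7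

end Stmt

/-- **thickness_fit_proof** — the first stub's statement PROVED: blueprint step 3 by the annihilating product
functional (THIS LINE'S LEVER, machine-checked end to end; = gen-1 `thickness_fit`).  `c i j e` is an abstract
coefficient tensor (for the crux: `coeff e (f i j)`), `a` the strict `l`-top surviving word, `b` a word of the
frame that is letterwise `l`-above `a` (`hba`) and alive in every coordinate for every product alive at `a` (`hbI`).
Then `b` and `a` differ in `< k` places.  Proof: on the sub-cube `Π_{j ∈ J} {a j, b j} × Π_{j ∉ J} {a j}`,
`J = {j : b j ≠ a j}`, every word other than `a` is `l`-≥ `a` (additivity of `l ∘ emb` over letters, `hba`) and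
`≠ a`, hence has `T = 0` by `htop`; with `x i = Π_{j∉J} c i j (a j)`, `φ i j true = c i j (a j)`,
`φ i j false = c i j (b j)` the trichotomy of `thickness_of_annihilator` holds (`hbI` for alive terms; a term
dead at `a` is dead inside `J` or has `x i = 0`), and that theorem gives `card J < k`.  No dissociation and no
genericity of `l` are needed.  This is the proof a worker lands for the registered `stub_thicknessFit`
(`Theorems/…DissociatedFixedKThickness.lean`, §0 + this theorem ≈ 280 lines, `propose --supports stmt-ValiantsHypothesis-5907`). -/
theorem thickness_fit_proof : Stmt.stub_thicknessFit := by
  intro k m A c l a b ha hb hTa htop hbI hba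
  classical
  set J : Finset (Fin m) := Finset.univ.filter fun j => b j ≠ a j with hJ
  -- sub-cube data: value outside `J`, two letters inside `J` (`true ↦ a j`, `false ↦ b j`)
  let x : Fin k → ℂ := fun i => ∏ j ∈ Jᶜ, c i j (a j)
  let φ : Fin k → ↥J → Bool → ℂ := fun i j y => c i j (cond y (a j) (b j))
  -- the grid word of a cube corner
  let wd : (↥J → Bool) → Fin m → (Fin 2 →₀ ℕ) := fun y j =>
    if h : j ∈ J then cond (y ⟨j, h⟩) (a j) (b j) else a j
  have hwdA : ∀ y j, wd y j ∈ A j := by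
    intro y j
    simp only [wd]
    split_ifs with h
    · rcases Bool.eq_false_or_eq_true (y ⟨j, h⟩) with hy | hy
      · rw [hy]; exact ha j
      · rw [hy]; exact hb j
    · exact ha j
  -- tensor value at a corner = the cube expression
  have hT : ∀ y, (∑ i, ∏ j, c i j (wd y j)) = ∑ i, x i * ∏ j : ↥J, φ i j (y j) := by
    intro y
    refine Finset.sum_congr rfl fun i _ => ?_
    rw [← Finset.prod_mul_prod_compl J (fun j => c i j (wd y j)), mul_comm]
    congr 1
    · show ∏ j ∈ Jᶜ, c i j (wd y j) = ∏ j ∈ Jᶜ, c i j (a j)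
      refine Finset.prod_congr rfl fun j hj => ?_
      have hj' : j ∉ J := Finset.mem_compl.1 hj
      simp only [wd, dif_neg hj']
    · show ∏ j ∈ J, c i j (wd y j) = ∏ j : ↥J, φ i j (y j)
      rw [← Finset.prod_coe_sort J]
      refine Finset.prod_congr rfl fun j _ => ?_
      simp only [wd, φ, dif_pos j.2, Subtype.coe_eta]
  -- `l ∘ emb` is additive over the letters of a word
  have e1 : ∀ w : Fin m → (Fin 2 →₀ ℕ),
      l (fun i : Fin 2 => (((∑ j, w j) i : ℕ) : ℝ)) = ∑ j, l (fun i : Fin 2 => (((w j) i : ℕ) : ℝ)) := by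
    intro w
    have e0 : (fun i : Fin 2 => (((∑ j, w j) i : ℕ) : ℝ))
        = ∑ j, (fun i : Fin 2 => (((w j) i : ℕ) : ℝ)) := by
      funext i
      simp only [Finsupp.coe_finsetSum, Finset.sum_apply, Nat.cast_sum]
    rw [e0, map_sum]
  -- every corner other than the all-`true` corner is cancelled
  have hzero : ∀ y : ↥J → Bool, y ≠ (fun _ => true) → ∑ i, x i * ∏ j : ↥J, φ i j (y j) = 0 := by
    intro y hy
    rw [← hT y]
    by_contra hne
    -- the corner word differs from `a`
    have hwa : wd y ≠ a := by
      intro heq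
      obtain ⟨j, hj⟩ := Function.ne_iff.1 hy
      have hyj : y j = false := by simpa using hj
      have h1 := congrFun heq j
      simp only [wd, dif_pos j.2, Subtype.coe_eta, hyj, cond_false] at h1
      exact (Finset.mem_filter.1 j.2).2 h1
    -- but it is `l`-at-least `a`
    have hge : l (fun i : Fin 2 => (((∑ j, a j) i : ℕ) : ℝ))
        ≤ l (fun i : Fin 2 => (((∑ j, wd y j) i : ℕ) : ℝ)) := by
      rw [e1 a, e1 (wd y)]
      refine Finset.sum_le_sum fun j _ => ?_
      by_cases hj : j ∈ J
      · simp only [wd, dif_pos hj]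
        rcases Bool.eq_false_or_eq_true (y ⟨j, hj⟩) with hy' | hy'
        · rw [hy']; exact le_rfl
        · rw [hy']; exact hba j
      · simp only [wd, dif_neg hj]
        exact le_rfl
    exact absurd (htop (wd y) (hwdA y) hwa hne) (not_lt.2 hge)
  -- the all-`true` corner is `a` itself and survives
  have hwtrue : wd (fun _ => true) = a := by
    funext j
    by_cases hj : j ∈ J
    · simp only [wd, dif_pos hj, cond_true]
    · simp only [wd, dif_neg hj]
  have htop' : ∑ i, x i * ∏ j : ↥J, φ i j true ≠ 0 := by
    have h := (hT (fun _ => true)).symm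
    simp only [hwtrue] at h
    rw [h]
    exact hTa
  -- trichotomy: negligible / alive at the `false` corner / dead at the `true` corner
  have hstruct : ∀ i, x i = 0 ∨ (∀ j : ↥J, φ i j false ≠ 0) ∨ (∃ j : ↥J, φ i j true = 0) := by
    intro i
    by_cases hal : ∀ j, c i j (a j) ≠ 0
    · exact Or.inr (Or.inl fun j => hbI i hal j)
    · push Not at hal
      obtain ⟨j₀, hj₀⟩ := hal
      by_cases hjJ : j₀ ∈ J
      · exact Or.inr (Or.inr ⟨⟨j₀, hjJ⟩, hj₀⟩)
      · exact Or.inl (Finset.prod_eq_zero (Finset.mem_compl.2 hjJ) hj₀)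
  have hlt := thickness_of_annihilator x φ hstruct hzero htop'
  rwa [Fintype.card_coe] at hlt


/-! ## §2  The registered stubs (the open work of the line as the LEAD cut it; `sorry` lives only here) -/

/-- **stub_thicknessFit** — REGISTERED (lead, 02:29Z; signature text = gen-1 `thickness_fit`).  PROVED in this
file as `thickness_fit_proof` (§1); it is a stub only so that its proof lands as a separate ≤ 400-line Theorems
helper matched by `--supports`.  Statement: see `thickness_fit_proof`. -/
theorem stub_thicknessFit {k m : ℕ} (A : Fin m → Finset (Fin 2 →₀ ℕ))
    (c : Fin k → Fin m → (Fin 2 →₀ ℕ) → ℂ) (l : (Fin 2 → ℝ) →L[ℝ] ℝ)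
    (a b : Fin m → (Fin 2 →₀ ℕ)) (ha : ∀ j, a j ∈ A j) (hb : ∀ j, b j ∈ A j)
    (hTa : (∑ i, ∏ j, c i j (a j)) ≠ 0)
    (htop : ∀ a' : Fin m → (Fin 2 →₀ ℕ), (∀ j, a' j ∈ A j) → a' ≠ a →
      (∑ i, ∏ j, c i j (a' j)) ≠ 0 →
      l (fun i : Fin 2 => (((∑ j, a' j) i : ℕ) : ℝ)) < l (fun i : Fin 2 => (((∑ j, a j) i : ℕ) : ℝ)))
    (hbI : ∀ i, (∀ j, c i j (a j) ≠ 0) → ∀ j, c i j (b j) ≠ 0)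
    (hba : ∀ j, l (fun i : Fin 2 => (((a j) i : ℕ) : ℝ)) ≤ l (fun i : Fin 2 => (((b j) i : ℕ) : ℝ))) :
    (Finset.univ.filter fun j => b j ≠ a j).card < k := by
  sorry


/-- **stub_exposedWord** — blueprint steps 1–2 (dictionary + strict exposure).  Every vertex of the
Newton polygon of `Σ_i Π_j f_ij` on a dissociated frame is `emb (Σ_j a_j)` for a grid word `a` with
nonzero tensor value, which is the STRICT maximiser, among all surviving grid words, of some continuous
linear functional `l` on `ℝ²`.  [Hahn–Banach against the hull of the other (finitely many) support
points = Disproof.lean v3 §E0 `exists_strict_sep_of_mem_extremePoints_convexHull`; coefficient/support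
formula = §E1 `coeff_sum_prod_of_dissociated`, `exists_word_of_mem_support` (also SketchIdeator3
`coeff_sum_prod_of_injective`, `support_sum_prod_subset`); `emb` is injective.] -/
theorem stub_exposedWord {k m : ℕ} (A : Fin m → Finset (Fin 2 →₀ ℕ))
    (f : Fin k → Fin m → MvPolynomial (Fin 2) ℂ)
    (hf : ∀ i j, (f i j).support ⊆ A j)
    (hinj : ∀ a b : Fin m → (Fin 2 →₀ ℕ), (∀ j, a j ∈ A j) → (∀ j, b j ∈ A j) →
      ∑ j, a j = ∑ j, b j → a = b)
    (p : Fin 2 → ℝ)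
    (hp : p ∈ Set.extremePoints ℝ (convexHull ℝ
      ((fun e : Fin 2 →₀ ℕ => fun i : Fin 2 => ((e i : ℕ) : ℝ)) ''
        ((∑ i, ∏ j, f i j).support : Set (Fin 2 →₀ ℕ))))) :
    ∃ (a : Fin m → (Fin 2 →₀ ℕ)) (l : (Fin 2 → ℝ) →L[ℝ] ℝ),
      (∀ j, a j ∈ A j) ∧
      p = (fun i : Fin 2 => (((∑ j, a j) i : ℕ) : ℝ)) ∧
      (∑ i, ∏ j, (f i j).coeff (a j)) ≠ 0 ∧
      ∀ a' : Fin m → (Fin 2 →₀ ℕ), (∀ j, a' j ∈ A j) → a' ≠ a →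
        (∑ i, ∏ j, (f i j).coeff (a' j)) ≠ 0 →
        l (fun i : Fin 2 => (((∑ j, a' j) i : ℕ) : ℝ)) < l (fun i : Fin 2 => (((∑ j, a j) i : ℕ) : ℝ)) := by
  sorry

/-- **stub_topTupleCount** — blueprint step 4 (counting the box tops).  For letter sets `S j` with
`#S j ≤ t`, the tuples `b ∈ Π_j S j` which, for SOME continuous linear functional `l`, are coordinatewise
maximal for the lexicographic key `e ↦ (l (emb e), e 0, e 1)` number at most `4 (m t)² + 7`.
[The key-top tuple depends on `l` only through the comparison pattern of `l` on the `≤ m t` letters,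
and an arbitrary functional on a finite planar set `P` has `≤ 4|P|² + 7` comparison patterns:
Disproof.lean v3 §E3 `ncard_range_cmpPat_le` + §E4 `lexTop_eq_of_cmpPat_eq`, `ncard_range_topTuple_le`
(all CHECKED there); alternative: the keyed slope sweep, SketchIdeator2 `sweep_boxTop_ncard_le`
(`≤ 2(m(t-1)+1)` for functionals with nonzero second coordinate).] -/
theorem stub_topTupleCount (m t : ℕ) (S : Fin m → Finset (Fin 2 →₀ ℕ)) (hS : ∀ j, (S j).card ≤ t) :
    ((Fintype.piFinset S).filter fun b : Fin m → (Fin 2 →₀ ℕ) =>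
        ∃ l : (Fin 2 → ℝ) →L[ℝ] ℝ, ∀ j, ∀ e ∈ S j,
          (toLex (l (fun i : Fin 2 => ((e i : ℕ) : ℝ)), toLex (e 0, e 1)) : Lex (ℝ × Lex (ℕ × ℕ)))
            ≤ toLex (l (fun i : Fin 2 => (((b j) i : ℕ) : ℝ)), toLex ((b j) 0, (b j) 1))).card
      ≤ 4 * (m * t) ^ 2 + 7 := by
  sorry


/-! ## §3  Encoding helpers for the assembly (PROVED) -/

/-- Decode: the letter for coordinate `j` is read off the slot list `L` (any slot carrying `j`),
defaulting to `b j` when no slot carries `j`. -/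
def word {k m : ℕ} (L : Fin k → Option (Fin m × (Fin 2 →₀ ℕ)))
    (b : Fin m → (Fin 2 →₀ ℕ)) (j : Fin m) : Fin 2 →₀ ℕ :=
  if h : ∃ s : Fin k, ∃ e : Fin 2 →₀ ℕ, L s = some (j, e) then (Classical.choose_spec h).choose
  else b j

theorem word_eq {k m : ℕ} {L : Fin k → Option (Fin m × (Fin 2 →₀ ℕ))}
    {b a : Fin m → (Fin 2 →₀ ℕ)} {j : Fin m}
    (hfaith : ∀ (s : Fin k) (e : Fin 2 →₀ ℕ), L s = some (j, e) → e = a j)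
    (hcov : (∃ s : Fin k, ∃ e : Fin 2 →₀ ℕ, L s = some (j, e)) ∨ b j = a j) :
    word L b j = a j := by
  unfold word
  split_ifs with h
  · exact hfaith _ _ (Classical.choose_spec h).choose_spec
  · rcases hcov with h' | h'
    · exact absurd h' h
    · exact h'

/-- Encode: the canonical slot list of a coordinate set `J` (in increasing order) with the letters of
`a`, padded with `none`. -/
def canon {k m : ℕ} (J : Finset (Fin m)) (a : Fin m → (Fin 2 →₀ ℕ)) (s : Fin k) :
    Option (Fin m × (Fin 2 →₀ ℕ)) :=
  if h : (s : ℕ) < J.card then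
    some (J.orderEmbOfFin rfl ⟨s, h⟩, a (J.orderEmbOfFin rfl ⟨s, h⟩))
  else none

theorem canon_apply_of_eq {k m : ℕ} (J : Finset (Fin m)) (a : Fin m → (Fin 2 →₀ ℕ)) (s : Fin k)
    (r : Fin J.card) (hs : (s : ℕ) = r) :
    canon J a s = some (J.orderEmbOfFin rfl r, a (J.orderEmbOfFin rfl r)) := by
  have h : (s : ℕ) < J.card := hs ▸ r.2
  unfold canon
  rw [dif_pos h]
  have e1 : (⟨(s : ℕ), h⟩ : Fin J.card) = r := Fin.ext hs
  rw [e1]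

theorem canon_faithful {k m : ℕ} {J : Finset (Fin m)} {a : Fin m → (Fin 2 →₀ ℕ)} {s : Fin k}
    {j : Fin m} {e : Fin 2 →₀ ℕ} (hs : canon J a s = some (j, e)) : j ∈ J ∧ e = a j := by
  unfold canon at hs
  by_cases h : (s : ℕ) < J.card
  · rw [dif_pos h] at hs
    simp only [Option.some.injEq, Prod.mk.injEq] at hs
    obtain ⟨hj, he⟩ := hs
    subst hj
    exact ⟨Finset.orderEmbOfFin_mem _ _ _, he.symm⟩
  · rw [dif_neg h] at hs
    exact absurd hs (by simp)

theorem canon_covers {k m : ℕ} {J : Finset (Fin m)} {a : Fin m → (Fin 2 →₀ ℕ)} {j : Fin m}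
    (hj : j ∈ J) (hJ : J.card ≤ k) :
    ∃ s : Fin k, ∃ e : Fin 2 →₀ ℕ, canon J a s = some (j, e) := by
  have hr : j ∈ Set.range (J.orderEmbOfFin rfl) := by
    rw [Finset.range_orderEmbOfFin, Finset.mem_coe]
    exact hj
  obtain ⟨r, hr⟩ := hr
  refine ⟨⟨r, lt_of_lt_of_le r.2 hJ⟩, a j, ?_⟩
  rw [canon_apply_of_eq J a ⟨r, lt_of_lt_of_le r.2 hJ⟩ r rfl, hr]

theorem canon_mem {k m : ℕ} (A : Fin m → Finset (Fin 2 →₀ ℕ)) {J : Finset (Fin m)}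
    {a : Fin m → (Fin 2 →₀ ℕ)} (ha : ∀ j, a j ∈ A j) (s : Fin k) :
    canon J a s ∈ Finset.insertNone (Finset.univ.biUnion fun j => (A j).image (Prod.mk j)) := by
  unfold canon
  by_cases h : (s : ℕ) < J.card
  · rw [dif_pos h, Finset.some_mem_insertNone]
    refine Finset.mem_biUnion.2 ⟨J.orderEmbOfFin rfl ⟨s, h⟩, Finset.mem_univ _, ?_⟩
    exact Finset.mem_image.2 ⟨_, ha _, rfl⟩
  · rw [dif_neg h]
    exact Finset.none_mem_insertNone

/-- The final arithmetic: `2^k (mt+1)^k (4(mt)²+7) ≤ (mt+2)^(2k+3)`. -/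
theorem count_arith (k m t : ℕ) :
    2 ^ k * ((m * t + 1) ^ k * (4 * (m * t) ^ 2 + 7)) ≤ (m * t + 2) ^ (2 * k + 3) := by
  have h2k : 2 ^ k ≤ (m * t + 2) ^ k := Nat.pow_le_pow_left (by omega) k
  have hmk : (m * t + 1) ^ k ≤ (m * t + 2) ^ k := Nat.pow_le_pow_left (by omega) k
  have hlast : 4 * (m * t) ^ 2 + 7 ≤ (m * t + 2) ^ 3 := by
    have e : (m * t + 2) ^ 3 = (m * t) ^ 3 + 6 * (m * t) ^ 2 + 12 * (m * t) + 8 := by ring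
    rw [e]
    have h0 : 0 ≤ (m * t) ^ 3 := Nat.zero_le _
    omega
  calc 2 ^ k * ((m * t + 1) ^ k * (4 * (m * t) ^ 2 + 7))
      ≤ (m * t + 2) ^ k * ((m * t + 2) ^ k * (m * t + 2) ^ 3) :=
        Nat.mul_le_mul h2k (Nat.mul_le_mul hmk hlast)
    _ = (m * t + 2) ^ (2 * k + 3) := by ring


/-! ## §4  The composition `DissociatedFixedK_of` (real proof) and the by-name skeleton theorem -/

/-- **Composition (protocol shape `stub-statements → crux`).**  The crux BY NAME from the three stub
STATEMENTS `Stmt.stub_thicknessFit`, `Stmt.stub_exposedWord`, `Stmt.stub_topTupleCount`, with `C = 2k + 3`;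
no `sorry` anywhere in its closure (axioms {propext, Classical.choice, Quot.sound}). -/
theorem DissociatedFixedK_of :
    Stmt.stub_thicknessFit → Stmt.stub_exposedWord → Stmt.stub_topTupleCount →
      Summit.ValiantsHypothesis.ValiantsHypothesis.Theses.NewtonUnitEquations.DissociatedFixedK := by
  intro hF hE hT k
  refine ⟨2 * k + 3, ?_⟩
  intro m t A f hA hf hinj
  -- the coefficient tensor and the alive boxes `C I j`
  set c : Fin k → Fin m → (Fin 2 →₀ ℕ) → ℂ := fun i j e => (f i j).coeff e with hc
  set C : Finset (Fin k) → Fin m → Finset (Fin 2 →₀ ℕ) := fun I j =>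
    (A j).filter fun e => ∀ i ∈ I, c i j e ≠ 0 with hC
  have hCA : ∀ I j, C I j ⊆ A j := fun I j => Finset.filter_subset _ _
  have hCcard : ∀ I j, (C I j).card ≤ t := fun I j => (Finset.card_le_card (hCA I j)).trans (hA j)
  -- the box tops of pattern `I` (over all functionals), counted by the third hypothesis
  set BT : Finset (Fin k) → Finset (Fin m → (Fin 2 →₀ ℕ)) := fun I =>
    (Fintype.piFinset (C I)).filter fun b : Fin m → (Fin 2 →₀ ℕ) =>
      ∃ l : (Fin 2 → ℝ) →L[ℝ] ℝ, ∀ j, ∀ e ∈ C I j,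
        (toLex (l (fun i : Fin 2 => ((e i : ℕ) : ℝ)), toLex (e 0, e 1)) : Lex (ℝ × Lex (ℕ × ℕ)))
          ≤ toLex (l (fun i : Fin 2 => (((b j) i : ℕ) : ℝ)), toLex ((b j) 0, (b j) 1)) with hBT
  have hBTcard : ∀ I, (BT I).card ≤ 4 * (m * t) ^ 2 + 7 := fun I =>
    hT m t (C I) (hCcard I)
  -- the letters and the slot lists
  set LET : Finset (Fin m × (Fin 2 →₀ ℕ)) :=
    Finset.univ.biUnion fun j => (A j).image (Prod.mk j) with hLET
  set LST : Finset (Fin k → Option (Fin m × (Fin 2 →₀ ℕ))) :=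
    Fintype.piFinset fun _ => Finset.insertNone LET with hLST
  have hLETcard : LET.card ≤ m * t := by
    calc LET.card ≤ ∑ j, ((A j).image (Prod.mk j)).card := Finset.card_biUnion_le
      _ ≤ ∑ _j : Fin m, t := Finset.sum_le_sum fun j _ => Finset.card_image_le.trans (hA j)
      _ = m * t := by simp
  have hLSTcard : LST.card ≤ (m * t + 1) ^ k := by
    have e : LST.card = (LET.card + 1) ^ k := by
      simp only [hLST, Fintype.card_piFinset, Finset.card_insertNone, Finset.prod_const,
        Finset.card_univ, Fintype.card_fin]
    rw [e]
    exact Nat.pow_le_pow_left (by omega) k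
  -- the covering finset
  set U : Finset (Fin 2 → ℝ) := (Finset.univ : Finset (Finset (Fin k))).biUnion fun I =>
    LST.biUnion fun L => (BT I).image fun b =>
      (fun i : Fin 2 => (((∑ j, word L b j) i : ℕ) : ℝ)) with hU
  have hUcard : U.card ≤ 2 ^ k * ((m * t + 1) ^ k * (4 * (m * t) ^ 2 + 7)) := by
    calc U.card
        ≤ ∑ I : Finset (Fin k), (LST.biUnion fun L => (BT I).image fun b =>
            (fun i : Fin 2 => (((∑ j, word L b j) i : ℕ) : ℝ))).card := Finset.card_biUnion_le
      _ ≤ ∑ I : Finset (Fin k), ∑ L ∈ LST, ((BT I).image fun b =>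
            (fun i : Fin 2 => (((∑ j, word L b j) i : ℕ) : ℝ))).card :=
          Finset.sum_le_sum fun I _ => Finset.card_biUnion_le
      _ ≤ ∑ I : Finset (Fin k), ∑ L ∈ LST, (4 * (m * t) ^ 2 + 7) :=
          Finset.sum_le_sum fun I _ => Finset.sum_le_sum fun L _ =>
            Finset.card_image_le.trans (hBTcard I)
      _ = Fintype.card (Finset (Fin k)) * (LST.card * (4 * (m * t) ^ 2 + 7)) := by
          simp only [Finset.sum_const, smul_eq_mul, Finset.card_univ]
      _ ≤ 2 ^ k * ((m * t + 1) ^ k * (4 * (m * t) ^ 2 + 7)) := by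
          rw [Fintype.card_finset, Fintype.card_fin]
          exact Nat.mul_le_mul_left _ (Nat.mul_le_mul_right _ hLSTcard)
  -- every vertex is covered
  have hcover : Set.extremePoints ℝ (convexHull ℝ
      ((fun e : Fin 2 →₀ ℕ => fun i : Fin 2 => ((e i : ℕ) : ℝ)) ''
        ((∑ i, ∏ j, f i j).support : Set (Fin 2 →₀ ℕ)))) ⊆ ↑U := by
    intro p hp
    obtain ⟨a, l, ha, hpa, hTa, htop⟩ := hE A f hf hinj p hp
    -- alive pattern of `a` and its box
    set I : Finset (Fin k) := Finset.univ.filter fun i => ∀ j, c i j (a j) ≠ 0 with hI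
    have haC : ∀ j, a j ∈ C I j := by
      intro j
      refine Finset.mem_filter.2 ⟨ha j, fun i hi => ?_⟩
      exact (Finset.mem_filter.1 hi).2 j
    -- coordinatewise lexicographic tops of the box
    have hex : ∀ j, ∃ bj ∈ C I j, ∀ e ∈ C I j,
        (toLex (l (fun i : Fin 2 => ((e i : ℕ) : ℝ)), toLex (e 0, e 1)) : Lex (ℝ × Lex (ℕ × ℕ)))
          ≤ toLex (l (fun i : Fin 2 => ((bj i : ℕ) : ℝ)), toLex (bj 0, bj 1)) := fun j =>
      Finset.exists_max_image (C I j)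
        (fun e : Fin 2 →₀ ℕ =>
          (toLex (l (fun i : Fin 2 => ((e i : ℕ) : ℝ)), toLex (e 0, e 1)) : Lex (ℝ × Lex (ℕ × ℕ))))
        ⟨a j, haC j⟩
    choose b hbC hbmax using hex
    have hbA : ∀ j, b j ∈ A j := fun j => hCA I j (hbC j)
    have hba : ∀ j, l (fun i : Fin 2 => (((a j) i : ℕ) : ℝ)) ≤ l (fun i : Fin 2 => (((b j) i : ℕ) : ℝ)) := by
      intro j
      have h := hbmax j (a j) (haC j)
      rw [Prod.Lex.toLex_le_toLex] at h
      rcases h with h | ⟨h, _⟩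
      · exact h.le
      · exact h.le
    have hbI : ∀ i, (∀ j, c i j (a j) ≠ 0) → ∀ j, c i j (b j) ≠ 0 := by
      intro i hi j
      have hiI : i ∈ I := Finset.mem_filter.2 ⟨Finset.mem_univ _, hi⟩
      exact (Finset.mem_filter.1 (hbC j)).2 i hiI
    -- thickness (the lever, first hypothesis)
    have hthick : (Finset.univ.filter fun j => b j ≠ a j).card < k :=
      hF A c l a b ha hbA hTa htop hbI hba
    set J : Finset (Fin m) := Finset.univ.filter fun j => b j ≠ a j with hJ
    -- decoding the canonical slot list of `(J, a)` against `b` returns `a`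
    have hword : ∀ j, word (canon (k := k) J a) b j = a j := by
      intro j
      apply word_eq (a := a)
      · intro s e hs
        exact (canon_faithful hs).2
      · by_cases hj : j ∈ J
        · exact Or.inl (canon_covers hj hthick.le)
        · right
          by_contra hne
          exact hj (Finset.mem_filter.2 ⟨Finset.mem_univ _, hne⟩)
    have hsum : (∑ j, word (canon (k := k) J a) b j) = ∑ j, a j :=
      Finset.sum_congr rfl fun j _ => hword j
    -- membership in the covering finset
    rw [Finset.mem_coe]
    refine Finset.mem_biUnion.2 ⟨I, Finset.mem_univ _, ?_⟩
    refine Finset.mem_biUnion.2 ⟨canon (k := k) J a, ?_, ?_⟩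
    · exact Fintype.mem_piFinset.2 fun s => canon_mem A ha s
    · refine Finset.mem_image.2 ⟨b, ?_, ?_⟩
      · exact Finset.mem_filter.2 ⟨Fintype.mem_piFinset.2 hbC, l, fun j e he => hbmax j e he⟩
      · rw [hpa, hsum]
  -- conclude
  calc (Set.extremePoints ℝ (convexHull ℝ
          ((fun e : Fin 2 →₀ ℕ => fun i : Fin 2 => ((e i : ℕ) : ℝ)) ''
            ((∑ i, ∏ j, f i j).support : Set (Fin 2 →₀ ℕ))))).ncard
      ≤ (↑U : Set (Fin 2 → ℝ)).ncard := Set.ncard_le_ncard hcover U.finite_toSet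
    _ = U.card := Set.ncard_coe_finset U
    _ ≤ 2 ^ k * ((m * t + 1) ^ k * (4 * (m * t) ^ 2 + 7)) := hUcard
    _ ≤ (m * t + 2) ^ (2 * k + 3) := count_arith k m t


/-- **Skeleton theorem (by name).**  The crux `DissociatedFixedK` from the three REGISTERED stubs, as the
one-line instance of the composition; its only non-standard axiom is the `sorryAx` of the stubs, so landing
`stub_thicknessFit` (proof: §1), `stub_exposedWord`, `stub_topTupleCount` (each `propose --supports
stmt-ValiantsHypothesis-5907`, registered name + signature) and then this composition closes the crux. -/
theorem DissociatedFixedK_proof :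
    Summit.ValiantsHypothesis.ValiantsHypothesis.Theses.NewtonUnitEquations.DissociatedFixedK :=
  DissociatedFixedK_of @stub_thicknessFit @stub_exposedWord stub_topTupleCount

end

end Summit.ValiantsHypothesis.ValiantsHypothesis.Cruxes.DissociatedFixedK.AnnihilatorProductFunctional

/-! ## §X  Cross-checks against the LANDED Negative lemmas (scratch only — `Theorems/DissociatedFixedK/Negative/*`
are imported above; this section is not part of the published skeleton, whose farm check must not depend on
those modules being built in the snapshot). -/

namespace Summit.ValiantsHypothesis.ValiantsHypothesis.Cruxes.DissociatedFixedK.AnnihilatorProductFunctional.XCheck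

open scoped BigOperators Classical
open Summit.ValiantsHypothesis.ValiantsHypothesis.Theorems.DissociatedFixedK

/-- (X1) The statement of this line's lever `thickness_of_annihilator` also follows from the landed
`Negative.mixed_cube_lemma` (p73482): same trichotomy, same cube, conclusion `card J < k` versus
`∃ s, (∀ i ∈ s, x i ≠ 0) ∧ card J + 1 ≤ #s`.  So `stub_thicknessFit` / `thickness_fit_proof` has TWO independent kernel-checked cores. -/
theorem thickness_core_of_mixed_cube_lemma {k : ℕ} {J : Type*} [Fintype J] [DecidableEq J]
    (x : Fin k → ℂ) (φ : Fin k → J → Bool → ℂ)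
    (hstruct : ∀ i, x i = 0 ∨ (∀ j, φ i j false ≠ 0) ∨ (∃ j, φ i j true = 0))
    (hzero : ∀ y : J → Bool, y ≠ (fun _ => true) → ∑ i, x i * ∏ j, φ i j (y j) = 0)
    (htop : ∑ i, x i * ∏ j, φ i j true ≠ 0) : Fintype.card J < k := by
  classical
  obtain ⟨s, hs, hcard⟩ := Negative.mixed_cube_lemma x φ (∑ i, x i * ∏ j, φ i j true) htop rfl
    (fun ε ⟨j, hj⟩ => hzero ε (fun h => by simpa [congrFun h j] using hj))
    (fun i hi => (hstruct i).resolve_left hi)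
  have : s.card ≤ k := (Finset.card_le_univ s).trans (by simp)
  omega

/-- (X2) Conversely the lever gives the landed lemma's hypotheses' consequence in its own currency:
under `mixed_cube_lemma`'s hypotheses (live-term trichotomy), `card J < k`. -/
theorem annihilator_core_under_negative_hyps {k : ℕ} {J : Type*} [Fintype J] [DecidableEq J]
    (x : Fin k → ℂ) (v : Fin k → J → Bool → ℂ) (c : ℂ) (hc : c ≠ 0)
    (h1 : (∑ i, x i * ∏ j, v i j true) = c)
    (h0 : ∀ ε : J → Bool, (∃ j, ε j = false) → (∑ i, x i * ∏ j, v i j (ε j)) = 0)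
    (htri : ∀ i, x i ≠ 0 → (∀ j, v i j false ≠ 0) ∨ (∃ j, v i j true = 0)) :
    Fintype.card J < k := by
  classical
  refine thickness_of_annihilator x v ?_ ?_ (h1 ▸ hc |> fun h => by rwa [h1])
  · intro i
    by_cases hx : x i = 0
    · exact Or.inl hx
    · exact Or.inr (htri i hx)
  · intro y hy
    obtain ⟨j, hj⟩ := Function.ne_iff.1 hy
    exact h0 y ⟨j, by simpa using hj⟩

/-- (X3) The two bookkeeping hypotheses the landed `Negative/LoadBearing.lean` (p74111) proves load-bearing
are KEPT by this line: `#A j ≤ t` is consumed by `stub_topTupleCount` (as `#S j ≤ t`) and by the slot count,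
`supp f i j ⊆ A j` by `stub_exposedWord`.  The refuted deletions, by name: -/
example : ¬ Negative.DissociatedFixedKWithoutCard := Negative.dissociatedFixedK_false_without_card
example : ¬ Negative.DissociatedFixedKWithoutSupp := Negative.dissociatedFixedK_false_without_supp

/-- (X4) Sharpness respected (landed `cube_lemma_sharp_one/_two`): the lever proves `card J < k`, never
`card J + 1 < k`; with `k = 2` terms a `1`-cube IS realised, so `< k` is attained. -/
example : ∃ (x : Fin 2 → ℂ) (φ : Fin 2 → Unit → Bool → ℂ),
    (∀ i, x i = 0 ∨ (∀ j, φ i j false ≠ 0) ∨ (∃ j, φ i j true = 0)) ∧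
    (∀ y : Unit → Bool, y ≠ (fun _ => true) → ∑ i, x i * ∏ j, φ i j (y j) = 0) ∧
    (∑ i, x i * ∏ j, φ i j true ≠ 0) ∧ Fintype.card Unit + 1 = 2 := by
  -- `y = (1 + y) - 1`: terms `x₀ = 1, φ₀ = (1, 1+? )` … concretely φ₀(false)=1, φ₀(true)=2; φ₁ ≡ 1, x₁ = -1
  refine ⟨![1, -1], fun i _ b => if i = 0 then (if b then 2 else 1) else 1, ?_, ?_, ?_, by simp⟩
  · intro i
    exact Or.inr (Or.inl fun j => by fin_cases i <;> simp)
  · intro y hy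
    have hy' : y () = false := by
      by_contra h
      exact hy (funext fun u => by cases u; simpa using h)
    simp [Fin.sum_univ_two, hy']
  · simp [Fin.sum_univ_two]
    norm_num

end Summit.ValiantsHypothesis.ValiantsHypothesis.Cruxes.DissociatedFixedK.AnnihilatorProductFunctional.XCheck
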